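/-
Origin: expansion seat `planner-pub-hodgecm-pv14-g4-0`, handover #4 2026-08-18T08:58:33Z (`HOME/pub-hodgecm-pv14-g4/lean/Pv14g4/WeilThetaModelSchrodingerLinear.lean`, md5 f9cdeeae, 179 lines);
landed by the gen-7 packager in gate run 27 as `HodgeCM/Automorphic/WeilThetaModelSchrodingerLinear.lean` (import ^import Pv14g4\.→import HodgeCM.Automorphic. ×1).
-/
/-
Origin: HOME/pub-hodgecm-pv14-g4/lean/Pv14g4/WeilThetaModelSchrodingerLinear.lean — session planner-pub-hodgecm-pv14-g4-0
(unit pub-hodgecm-pv14-g4, DAG-NODE PROVER #14 gen 4).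
Intended final place (packager's call): `HodgeCM/Automorphic/WeilThetaModelSchrodingerLinear.lean`.
NEW ADDITIVE LEAF.  WIP import ↦ landed name: `Pv14g4.WeilThetaModelSchrodinger` ↦ `HodgeCM.Automorphic.WeilThetaModelSchrodinger`
(my HANDOVER #2; lands AFTER it); Mathlib only otherwise.
KIND: KERNEL — nothing cited, nothing posited.
-/
import Summits.HodgeConjecture.HodgeCM.Automorphic.WeilThetaModelSchrodinger

/-!
# The Schrödinger–lattice `WeilThetaModel`: `Θ` is a tempered DISTRIBUTION (linear + continuous in `Φ`)

Weil 1964 n° 41 treats `Φ ↦ Θ_Φ(S)` as a tempered distribution on `S(X_A)` (p. 194: continuity of `Φ ↦ Φ(x₀)`,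
Lemme 5; Bruhat [1], Schwartz [4] in the bibliography); prl1-g4's record `WeilThetaModel` keeps only its CONTINUITY
at `S = 1` (`dist_cont`, PRINT-DERIVED) because the assembly needs no more.  In the archimedean Schrödinger–lattice
model (`SchwartzWeil.schrodingerModel`, pv14-g4 #2) the full statement is a THEOREM, recorded here:

1. `act` and `theta` are `ℂ`-LINEAR in `Φ` (`act_add/act_smul/act_zero`, `theta_add/theta_smul/theta_zero`,
   `thetaLinear S : 𝓢(E, ℂ) →ₗ[ℂ] ℂ`);
2. **`thetaDistribution S : 𝓢(E, ℂ) →L[ℂ] ℂ`** — `Φ ↦ Θ_Φ(S)` is a continuous linear functional on the Schwartz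
   space, i.e. a tempered distribution, for EVERY `S ∈ Mp = E × U(1)` (linearity + `continuous_theta_left` of #2);
   at `S = 1` it is the lattice Dirac comb `thetaCLM L 0` (`thetaDistribution_one`);
3. through prl1-g4's record: the kernel map `Φ ↦ θ_Φ ∈ C((E ⧸ L) × (U(1) ⧸ Γ), ℂ)` on `SK = univ` is `ℂ`-linear
   (`θ_toSK_add/θ_toSK_smul`, **`θLinear`**), and the class-U action is the weight-`m` character on representatives
   (`act_one_left`, `omg_toSK : ω(u) Φ = u^m • Φ`).

Not duplicated: pv02-g5 `ArchAWeilSchrodinger` (weight law ON KERNELS `θ_{ω(u)Φ} = u^m • θ_Φ`, compactness of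
`E ⧸ L`, N27) proves none of these and is not imported.
-/

set_option autoImplicit false

noncomputable section

open Filter Topology Set
open scoped SchwartzMap

namespace HodgeCM
namespace SchwartzWeil

variable (E : Type) [NormedAddCommGroup E] [NormedSpace ℝ E] [FiniteDimensional ℝ E]
  (L : Submodule ℤ E) [DiscreteTopology L] (m : ℤ)

/-! ## 1. Linearity in `Φ` -/

omit [FiniteDimensional ℝ E] in
/-- (Ported verbatim from the HodgeCMPerL package; no docstring in the source.) -/
theorem act_add (S : Multiplicative E × Circle) (Φ Ψ : 𝓢(E, ℂ)) :
    act E m S (Φ + Ψ) = act E m S Φ + act E m S Ψ := by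
  simp only [act, map_add, smul_add]

omit [FiniteDimensional ℝ E] in
/-- (Ported verbatim from the HodgeCMPerL package; no docstring in the source.) -/
theorem act_smul (S : Multiplicative E × Circle) (c : ℂ) (Φ : 𝓢(E, ℂ)) :
    act E m S (c • Φ) = c • act E m S Φ := by
  simp only [act, map_smul, smul_comm c]

omit [FiniteDimensional ℝ E] in
/-- (Ported verbatim from the HodgeCMPerL package; no docstring in the source.) -/
@[simp] theorem act_zero (S : Multiplicative E × Circle) : act E m S (0 : 𝓢(E, ℂ)) = 0 := by
  simp only [act, map_zero, smul_zero]

omit [FiniteDimensional ℝ E] [DiscreteTopology L] in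
/-- (Ported verbatim from the HodgeCMPerL package; no docstring in the source.) -/
theorem theta_smul (c : ℂ) (Φ : 𝓢(E, ℂ)) (S : Multiplicative E × Circle) :
    theta E L m (c • Φ) S = c * theta E L m Φ S := by
  simp only [theta, act_smul, smul_apply, smul_eq_mul, tsum_mul_left]

/-- (Ported verbatim from the HodgeCMPerL package; no docstring in the source.) -/
theorem theta_add (Φ Ψ : 𝓢(E, ℂ)) (S : Multiplicative E × Circle) :
    theta E L m (Φ + Ψ) S = theta E L m Φ S + theta E L m Ψ S := by
  simp only [theta_eq_thetaCLM, act_add, map_add]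

omit [FiniteDimensional ℝ E] [DiscreteTopology L] in
/-- (Ported verbatim from the HodgeCMPerL package; no docstring in the source.) -/
@[simp] theorem theta_zero (S : Multiplicative E × Circle) : theta E L m (0 : 𝓢(E, ℂ)) S = 0 := by
  simp only [theta, act_zero, zero_apply, tsum_zero]

/-- `Φ ↦ Θ_Φ(S)` as a `ℂ`-linear functional. -/
def thetaLinear (S : Multiplicative E × Circle) : 𝓢(E, ℂ) →ₗ[ℂ] ℂ where
  toFun Φ := theta E L m Φ S
  map_add' Φ Ψ := theta_add E L m Φ Ψ S
  map_smul' c Φ := theta_smul E L m c Φ S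

/-- (Ported verbatim from the HodgeCMPerL package; no docstring in the source.) -/
@[simp] theorem thetaLinear_apply (S : Multiplicative E × Circle) (Φ : 𝓢(E, ℂ)) :
    thetaLinear E L m S Φ = theta E L m Φ S := rfl

/-! ## 2. prl1-g4's kernels in the model: linearity and the weight-`m` law -/

section Kernels

variable (Γ : Subgroup Circle) (hΓ : ∀ u ∈ Γ, u ^ m = 1)

/-- The element of `SK = univ` carried by `Φ`. -/
abbrev toSK (Φ : 𝓢(E, ℂ)) : (schrodingerModel E L m Γ hΓ).SK := ⟨Φ, Set.mem_univ Φ⟩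

omit [FiniteDimensional ℝ E] [DiscreteTopology L] in
/-- The class-U action `ω(h) Φ := s(1, h) • Φ` of the model is the weight-`m` character: `ω(u) Φ = u ^ m • Φ`. -/
theorem act_one_left (u : Circle) (Φ : 𝓢(E, ℂ)) :
    act E m ((1 : Multiplicative E), u) Φ = ((u : ℂ) ^ m) • Φ := by
  ext x
  simp

/-- In the model `ω(u) Φ = u ^ m • Φ` (on `SK = univ`). -/
theorem omg_toSK (u : Circle) (Φ : 𝓢(E, ℂ)) :
    (schrodingerModel E L m Γ hΓ).omg u (toSK E L m Γ hΓ Φ) = toSK E L m Γ hΓ (((u : ℂ) ^ m) • Φ) := by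
  apply Subtype.ext
  rw [WeilThetaModel.coe_omg]
  exact act_one_left E m u Φ

/-- The kernel on representatives, through `theta` (prl1-g4 `θ_mk`). -/
theorem θ_toSK_mk (Φ : 𝓢(E, ℂ)) (a : Multiplicative E) (u : Circle) :
    (schrodingerModel E L m Γ hΓ).θ (toSK E L m Γ hΓ Φ) (QuotientGroup.mk a, QuotientGroup.mk u) =
      theta E L m Φ ((a, u)⁻¹) :=
  WeilThetaModel.θ_mk _ _ a u

/-- `Φ ↦ θ_Φ` is additive … -/
theorem θ_toSK_add (Φ Ψ : 𝓢(E, ℂ)) :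
    (schrodingerModel E L m Γ hΓ).θ (toSK E L m Γ hΓ (Φ + Ψ)) =
      (schrodingerModel E L m Γ hΓ).θ (toSK E L m Γ hΓ Φ) + (schrodingerModel E L m Γ hΓ).θ (toSK E L m Γ hΓ Ψ) := by
  ext ⟨ξ, q⟩
  induction ξ using QuotientGroup.induction_on with
  | H a =>
    induction q using QuotientGroup.induction_on with
    | H u =>
      rw [ContinuousMap.add_apply, θ_toSK_mk, θ_toSK_mk, θ_toSK_mk, theta_add]

/-- … and `ℂ`-homogeneous. -/
theorem θ_toSK_smul (c : ℂ) (Φ : 𝓢(E, ℂ)) :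
    (schrodingerModel E L m Γ hΓ).θ (toSK E L m Γ hΓ (c • Φ)) = c • (schrodingerModel E L m Γ hΓ).θ (toSK E L m Γ hΓ Φ) := by
  ext ⟨ξ, q⟩
  induction ξ using QuotientGroup.induction_on with
  | H a =>
    induction q using QuotientGroup.induction_on with
    | H u =>
      rw [ContinuousMap.smul_apply, θ_toSK_mk, θ_toSK_mk, theta_smul, smul_eq_mul]

/-- `Φ ↦ θ_Φ` as a `ℂ`-linear map `𝓢(E, ℂ) →ₗ[ℂ] C((E ⧸ L) × (U(1) ⧸ Γ), ℂ)`. -/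
def θLinear : 𝓢(E, ℂ) →ₗ[ℂ] C((Multiplicative E ⧸ latticeSubgroup E L) × (Circle ⧸ Γ), ℂ) where
  toFun Φ := (schrodingerModel E L m Γ hΓ).θ (toSK E L m Γ hΓ Φ)
  map_add' := θ_toSK_add E L m Γ hΓ
  map_smul' := θ_toSK_smul E L m Γ hΓ

/-- (Ported verbatim from the HodgeCMPerL package; no docstring in the source.) -/
@[simp] theorem θLinear_apply (Φ : 𝓢(E, ℂ)) :
    θLinear E L m Γ hΓ Φ = (schrodingerModel E L m Γ hΓ).θ (toSK E L m Γ hΓ Φ) := rfl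


end Kernels

/-! ## 3. `Φ ↦ Θ_Φ(S)` is a tempered distribution -/

/-- **`Θ(·)(S)` is a tempered distribution**: `Φ ↦ Θ_Φ(S)` as a CONTINUOUS `ℂ`-linear functional on `𝓢(E, ℂ)`,
for every `S ∈ Mp = E × U(1)`. -/
def thetaDistribution (S : Multiplicative E × Circle) : 𝓢(E, ℂ) →L[ℂ] ℂ :=
  ⟨thetaLinear E L m S, continuous_theta_left E L m S⟩

/-- (Ported verbatim from the HodgeCMPerL package; no docstring in the source.) -/
@[simp] theorem thetaDistribution_apply (S : Multiplicative E × Circle) (Φ : 𝓢(E, ℂ)) :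
    thetaDistribution E L m S Φ = theta E L m Φ S := rfl

/-- At `S = 1` the distribution is the lattice Dirac comb `Φ ↦ Σ_{v ∈ L} Φ(v)` (`thetaCLM L 0` of #1). -/
theorem thetaDistribution_one (Φ : 𝓢(E, ℂ)) :
    thetaDistribution E L m 1 Φ = thetaCLM L (0 : E) Φ := by
  rw [thetaDistribution_apply, theta_eq_thetaCLM, act_one]

/-- Invariance of the distribution under `r_k(Ps_k)` = lattice translations × `m`-torsion, as an identity of
functionals: `Θ(·)(γ S) = Θ(·)(S)` for `γ ∈ rat` (Thm 6 in the model, #2 `theta_rat_mul`). -/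
theorem thetaDistribution_rat_mul {γ : Multiplicative E × Circle} (hγ : γ ∈ rat E L m)
    (S : Multiplicative E × Circle) :
    thetaDistribution E L m (γ * S) = thetaDistribution E L m S := by
  ext Φ
  simp only [thetaDistribution_apply]
  exact theta_rat_mul E L m Φ hγ S

/-- Equivariance `Θ_{S'Φ}(S) = Θ_Φ(S S')` as an identity of functionals: `Θ(·)(S) ∘ r(S') = Θ(·)(S S')`
(n° 39 in the model, #2 `theta_act`; `r(S')` = the continuous linear operator `Φ ↦ act S' Φ`). -/
theorem thetaDistribution_comp_act (S S' : Multiplicative E × Circle) (Φ : 𝓢(E, ℂ)) :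
    thetaDistribution E L m S (act E m S' Φ) = thetaDistribution E L m (S * S') Φ := by
  simp only [thetaDistribution_apply]
  exact theta_act E L m Φ S S'

end SchwartzWeil
end HodgeCM

end
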